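import Literature.Combinatorics.SimpleGraph.Menger
import HarnessLib

/-!
# Menger's theorem (set form): the gluing step of Göring's proof

Topic `Literature/Combinatorics/SimpleGraph`; continuation of `Menger.lean`. In the induction step
of Göring's proof of Menger's theorem (Chartrand–Jordon–Vatter–Zhang, *Graphs & Digraphs*, proof
of Thm. 4.17; Diestel, *Graph Theory*, Thm. 3.3.1, third proof) one has an edge `e = xy` of `G`, an
`A`–`B` separator `X` of `G - e` with `x, y ∉ X`, a system `P` of disjoint `A`–`(X ∪ {x})` paths of
`G - e` ending at every vertex of `X ∪ {x}`, and a system `Q` of disjoint `(X ∪ {y})`–`B` paths of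
`G - e` starting at every vertex of `X ∪ {y}`. This file packages these data (`GluingData`) and
GLUES them into a system of `|X| + 1` disjoint `A`–`B` paths of `G` (`GluingData.glue`, indexed
by `Option X`): the path through `z ∈ X` is `P_z ++ Q_z`, and the extra path is `P_x ++ xy ++ Q_y`.
The key observation (`GluingData.cross`): a `P`-path and a `Q`-path can only meet in a vertex of
`X`, which is then the last vertex of the one and the first vertex of the other — otherwise
`G - e` would contain an `A`–`B` walk avoiding `X`.

## References

* F. Göring, Short proof of Menger's theorem, *Discrete Math.* 219 (2000) 295–296.
* R. Diestel, *Graph Theory*, 5th ed. (2017), Thm. 3.3.1 [Diestel2017].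
* G. Chartrand, H. Jordon, V. Vatter, P. Zhang, *Graphs & Digraphs*, 7th ed. (2024), Thm. 4.17.
-/

namespace Literature.Combinatorics.SimpleGraph

open _root_.SimpleGraph

universe u

variable {V : Type u} [DecidableEq V] {G : _root_.SimpleGraph V} {A B : Set V}

/-- **The data of the gluing step** of Göring's proof (see the module docstring): the edge `xy`,
the separator `X` of `G - xy` avoiding `x` and `y`, the `A`–`(X ∪ {x})` paths `P` of `G - xy`
indexed by (and ending at) the vertices of `X ∪ {x}`, and the `(X ∪ {y})`–`B` paths `Q` of
`G - xy` indexed by (and starting at) the vertices of `X ∪ {y}`.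
[cite: Diestel2017, Thm. 3.3.1 (third proof)] -/
structure GluingData (G : _root_.SimpleGraph V) (A B : Set V) : Type u where
  /-- the separator of `G - xy` -/
  X : Finset V
  /-- the endpoint of the deleted edge on the `A` side -/
  x : V
  /-- the endpoint of the deleted edge on the `B` side -/
  y : V
  adj : G.Adj x y
  x_notMem : x ∉ X
  y_notMem : y ∉ X
  /-- `X` separates `A` from `B` in `G - xy` -/
  sep : IsVxSeparator (G.deleteEdges {s(x, y)}) A B ↑X
  /-- the `A`–`(X ∪ {x})` paths of `G - xy`, indexed by their last vertices -/
  P : ABPathSystem (G.deleteEdges {s(x, y)}) A ↑(insert x X) (↑(insert x X) : Set V)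
  lst_P : ∀ i, P.lst i = i
  /-- the `(X ∪ {y})`–`B` paths of `G - xy`, indexed by their first vertices -/
  Q : ABPathSystem (G.deleteEdges {s(x, y)}) ↑(insert y X) B (↑(insert y X) : Set V)
  fst_Q : ∀ j, Q.fst j = j

namespace GluingData

variable (D : GluingData G A B)

/-! ### Bookkeeping -/

/-- `x ≠ y`. [cite: Diestel2017, Thm. 3.3.1 (third proof)] -/
theorem x_ne_y : D.x ≠ D.y := D.adj.ne

/-- The index of the `P`-path ending at `x`. [cite: Diestel2017, Thm. 3.3.1 (third proof)] -/
def ix : (↑(insert D.x D.X) : Set V) := ⟨D.x, Finset.mem_insert_self _ _⟩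

/-- The index of the `Q`-path starting at `y`. [cite: Diestel2017, Thm. 3.3.1 (third proof)] -/
def iy : (↑(insert D.y D.X) : Set V) := ⟨D.y, Finset.mem_insert_self _ _⟩

/-- The index of the `P`-path ending at `z ∈ X`. [cite: Diestel2017, Thm. 3.3.1 (third proof)] -/
def iP (z : (↑D.X : Set V)) : (↑(insert D.x D.X) : Set V) := ⟨z, Finset.mem_insert_of_mem z.2⟩

/-- The index of the `Q`-path starting at `z ∈ X`. [cite: Diestel2017, Thm. 3.3.1 (third proof)] -/
def iQ (z : (↑D.X : Set V)) : (↑(insert D.y D.X) : Set V) := ⟨z, Finset.mem_insert_of_mem z.2⟩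

/-- The index `ix` is the vertex `x`. [cite: Diestel2017, Thm. 3.3.1 (third proof)] -/
@[simp] theorem coe_ix : (D.ix : V) = D.x := rfl
/-- The index `iy` is the vertex `y`. [cite: Diestel2017, Thm. 3.3.1 (third proof)] -/
@[simp] theorem coe_iy : (D.iy : V) = D.y := rfl
/-- The index `iP z` is the vertex `z`. [cite: Diestel2017, Thm. 3.3.1 (third proof)] -/
@[simp] theorem coe_iP (z : (↑D.X : Set V)) : (D.iP z : V) = z := rfl
/-- The index `iQ z` is the vertex `z`. [cite: Diestel2017, Thm. 3.3.1 (third proof)] -/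
@[simp] theorem coe_iQ (z : (↑D.X : Set V)) : (D.iQ z : V) = z := rfl

/-- The last vertex of `P_i` is `i`, so `i` lies on `P_i`. [cite: Diestel2017, Thm. 3.3.1 (third proof)] -/
theorem coe_mem_support_P (i : (↑(insert D.x D.X) : Set V)) : (i : V) ∈ (D.P.walk i).support := by
  rw [← D.lst_P i]; exact (D.P.walk i).end_mem_support

/-- The first vertex of `Q_j` is `j`, so `j` lies on `Q_j`. [cite: Diestel2017, Thm. 3.3.1 (third proof)] -/
theorem coe_mem_support_Q (j : (↑(insert D.y D.X) : Set V)) : (j : V) ∈ (D.Q.walk j).support := by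
  rw [← D.fst_Q j]; exact (D.Q.walk j).start_mem_support

/-! ### The crossing lemma -/

/-- **A `P`-path meets `B` only at its last vertex, which then lies in `X`**: a vertex `b ∈ B` on
`P_i` makes the prefix of `P_i` up to `b` an `A`–`B` walk of `G - xy`, which meets `X` — but `P_i`
meets `X ∪ {x}` only in its last vertex. [cite: Diestel2017, Thm. 3.3.1 (third proof)] -/
theorem eq_of_mem_P_of_mem_B {i : (↑(insert D.x D.X) : Set V)} {b : V}
    (hb : b ∈ (D.P.walk i).support) (hbB : b ∈ B) : b = i ∧ (i : V) ∈ D.X := by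
  classical
  obtain ⟨z, hz, hzX⟩ := D.sep (D.P.fst_mem i) hbB ((D.P.walk i).takeUntil b hb)
  have hzP : z ∈ (D.P.walk i).support := (D.P.walk i).support_takeUntil_subset_support hb hz
  have hzi : z = i := by
    rw [← D.lst_P i]
    exact D.P.eq_lst_of_mem i z hzP (Finset.mem_insert_of_mem hzX)
  have hbi : b = D.P.lst i :=
    IsPath.eq_of_mem_support_takeUntil_of_eq_end (D.P.isPath i) hb hz (hzi.trans (D.lst_P i).symm)
  rw [D.lst_P i] at hbi
  exact ⟨hbi, hzi ▸ hzX⟩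

/-- **A `Q`-path meets `A` only at its first vertex, which then lies in `X`** (symmetric).
[cite: Diestel2017, Thm. 3.3.1 (third proof)] -/
theorem eq_of_mem_Q_of_mem_A {j : (↑(insert D.y D.X) : Set V)} {a : V}
    (ha : a ∈ (D.Q.walk j).support) (haA : a ∈ A) : a = j ∧ (j : V) ∈ D.X := by
  classical
  obtain ⟨z, hz, hzX⟩ := D.sep haA (D.Q.lst_mem j) ((D.Q.walk j).dropUntil a ha)
  have hzQ : z ∈ (D.Q.walk j).support := (D.Q.walk j).support_dropUntil_subset_support ha hz
  have hzj : z = j := by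
    rw [← D.fst_Q j]
    exact D.Q.eq_fst_of_mem j z hzQ (Finset.mem_insert_of_mem hzX)
  have haj : a = D.Q.fst j :=
    IsPath.eq_of_mem_support_dropUntil_of_eq_start (D.Q.isPath j) ha hz (hzj.trans (D.fst_Q j).symm)
  rw [D.fst_Q j] at haj
  exact ⟨haj, hzj ▸ hzX⟩

/-- **The crossing lemma**: a common vertex `w` of `P_i` and `Q_j` lies in `X` and is the last
vertex of `P_i` and the first vertex of `Q_j` (so `i = w = j`): otherwise the prefix of `P_i` up to
`w` followed by the suffix of `Q_j` from `w` is an `A`–`B` walk of `G - xy`, which meets `X` in a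
vertex that is either an inner vertex of `P_i` in `X ∪ {x}` or an inner vertex of `Q_j` in
`X ∪ {y}` — impossible. [cite: Diestel2017, Thm. 3.3.1 (third proof)] -/
theorem cross {i : (↑(insert D.x D.X) : Set V)} {j : (↑(insert D.y D.X) : Set V)} {w : V}
    (hwP : w ∈ (D.P.walk i).support) (hwQ : w ∈ (D.Q.walk j).support) :
    w ∈ D.X ∧ w = i ∧ w = j := by
  classical
  set p := D.P.walk i
  set q := D.Q.walk j
  obtain ⟨z, hz, hzX⟩ :=
    D.sep (D.P.fst_mem i) (D.Q.lst_mem j) ((p.takeUntil w hwP).append (q.dropUntil w hwQ))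
  rw [Walk.mem_support_append_iff] at hz
  rcases hz with hz | hz
  · -- `z` on the prefix of `P_i`: it is the last vertex of `P_i`, hence `w` is too
    have hzP : z ∈ p.support := p.support_takeUntil_subset_support hwP hz
    have hzi : z = i := by
      rw [← D.lst_P i]; exact D.P.eq_lst_of_mem i z hzP (Finset.mem_insert_of_mem hzX)
    have hwi : w = D.P.lst i :=
      IsPath.eq_of_mem_support_takeUntil_of_eq_end (D.P.isPath i) hwP hz
        (hzi.trans (D.lst_P i).symm)
    rw [D.lst_P i] at hwi
    have hwX : w ∈ D.X := hwi ▸ hzi ▸ hzX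
    refine ⟨hwX, hwi, ?_⟩
    rw [← D.fst_Q j]
    exact D.Q.eq_fst_of_mem j w hwQ (Finset.mem_insert_of_mem hwX)
  · -- `z` on the suffix of `Q_j`: it is the first vertex of `Q_j`, hence `w` is too
    have hzQ : z ∈ q.support := q.support_dropUntil_subset_support hwQ hz
    have hzj : z = j := by
      rw [← D.fst_Q j]; exact D.Q.eq_fst_of_mem j z hzQ (Finset.mem_insert_of_mem hzX)
    have hwj : w = D.Q.fst j :=
      IsPath.eq_of_mem_support_dropUntil_of_eq_start (D.Q.isPath j) hwQ hz
        (hzj.trans (D.fst_Q j).symm)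
    rw [D.fst_Q j] at hwj
    have hwX : w ∈ D.X := hwj ▸ hzj ▸ hzX
    refine ⟨hwX, ?_, hwj⟩
    rw [← D.lst_P i]
    exact D.P.eq_lst_of_mem i w hwP (Finset.mem_insert_of_mem hwX)

/-- `x` does not lie on any `Q`-path (it lies on `P_x` and is not in `X`).
[cite: Diestel2017, Thm. 3.3.1 (third proof)] -/
theorem x_notMem_support_Q (j : (↑(insert D.y D.X) : Set V)) : D.x ∉ (D.Q.walk j).support :=
  fun h => D.x_notMem (D.cross (D.coe_mem_support_P D.ix) h).1

/-- `y` does not lie on any `P`-path. [cite: Diestel2017, Thm. 3.3.1 (third proof)] -/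
theorem y_notMem_support_P (i : (↑(insert D.x D.X) : Set V)) : D.y ∉ (D.P.walk i).support :=
  fun h => D.y_notMem (D.cross h (D.coe_mem_support_Q D.iy)).1

/-! ### The glued walks -/

/-- The `P`-paths and `Q`-paths as walks of `G`. [cite: Diestel2017, Thm. 3.3.1 (third proof)] -/
def PG : ABPathSystem G A ↑(insert D.x D.X) (↑(insert D.x D.X) : Set V) :=
  D.P.mapLe (G.deleteEdges_le _)

/-- The `Q`-paths as walks of `G`. [cite: Diestel2017, Thm. 3.3.1 (third proof)] -/
def QG : ABPathSystem G ↑(insert D.y D.X) B (↑(insert D.y D.X) : Set V) :=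
  D.Q.mapLe (G.deleteEdges_le _)

/-- `P_x` as a walk of `G` ending literally at `x`. [cite: Diestel2017, Thm. 3.3.1 (third proof)] -/
def pthx : G.Walk (D.PG.fst D.ix) D.x := (D.PG.walk D.ix).copy rfl ((D.lst_P D.ix).trans D.coe_ix)

/-- `Q_y` as a walk of `G` starting literally at `y`. [cite: Diestel2017, Thm. 3.3.1 (third proof)] -/
def qthy : G.Walk D.y (D.QG.lst D.iy) := (D.QG.walk D.iy).copy ((D.fst_Q D.iy).trans D.coe_iy) rfl

/-- `P_z`, `z ∈ X`, as a walk of `G` ending literally at `z`. [cite: Diestel2017, Thm. 3.3.1 (third proof)] -/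
def pthz (z : (↑D.X : Set V)) : G.Walk (D.PG.fst (D.iP z)) z :=
  (D.PG.walk (D.iP z)).copy rfl ((D.lst_P (D.iP z)).trans (D.coe_iP z))

/-- `Q_z`, `z ∈ X`, as a walk of `G` starting literally at `z`. [cite: Diestel2017, Thm. 3.3.1 (third proof)] -/
def qthz (z : (↑D.X : Set V)) : G.Walk z (D.QG.lst (D.iQ z)) :=
  (D.QG.walk (D.iQ z)).copy ((D.fst_Q (D.iQ z)).trans (D.coe_iQ z)) rfl

/-- `P_x` keeps its vertices when viewed in `G`. [cite: Diestel2017, Thm. 3.3.1 (third proof)] -/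
@[simp] theorem support_pthx : D.pthx.support = (D.P.walk D.ix).support := by
  simp [pthx, PG, ABPathSystem.mapLe, Walk.support_transfer]

/-- `Q_y` keeps its vertices when viewed in `G`. [cite: Diestel2017, Thm. 3.3.1 (third proof)] -/
@[simp] theorem support_qthy : D.qthy.support = (D.Q.walk D.iy).support := by
  simp [qthy, QG, ABPathSystem.mapLe, Walk.support_transfer]

/-- `P_z` keeps its vertices when viewed in `G`. [cite: Diestel2017, Thm. 3.3.1 (third proof)] -/
@[simp] theorem support_pthz (z : (↑D.X : Set V)) : (D.pthz z).support = (D.P.walk (D.iP z)).support := by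
  simp [pthz, PG, ABPathSystem.mapLe, Walk.support_transfer]

/-- `Q_z` keeps its vertices when viewed in `G`. [cite: Diestel2017, Thm. 3.3.1 (third proof)] -/
@[simp] theorem support_qthz (z : (↑D.X : Set V)) : (D.qthz z).support = (D.Q.walk (D.iQ z)).support := by
  simp [qthz, QG, ABPathSystem.mapLe, Walk.support_transfer]

/-- `P_x` is a path of `G`. [cite: Diestel2017, Thm. 3.3.1 (third proof)] -/
theorem isPath_pthx : D.pthx.IsPath := by simpa [pthx] using D.PG.isPath D.ix
/-- `Q_y` is a path of `G`. [cite: Diestel2017, Thm. 3.3.1 (third proof)] -/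
theorem isPath_qthy : D.qthy.IsPath := by simpa [qthy] using D.QG.isPath D.iy
/-- `P_z` is a path of `G`. [cite: Diestel2017, Thm. 3.3.1 (third proof)] -/
theorem isPath_pthz (z : (↑D.X : Set V)) : (D.pthz z).IsPath := by
  simpa [pthz] using D.PG.isPath (D.iP z)
/-- `Q_z` is a path of `G`. [cite: Diestel2017, Thm. 3.3.1 (third proof)] -/
theorem isPath_qthz (z : (↑D.X : Set V)) : (D.qthz z).IsPath := by
  simpa [qthz] using D.QG.isPath (D.iQ z)

/-- First vertices of the glued paths. [cite: Diestel2017, Thm. 3.3.1 (third proof)] -/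
def glueFst : Option (↑D.X : Set V) → V
  | none => D.PG.fst D.ix
  | some z => D.PG.fst (D.iP z)

/-- Last vertices of the glued paths. [cite: Diestel2017, Thm. 3.3.1 (third proof)] -/
def glueLst : Option (↑D.X : Set V) → V
  | none => D.QG.lst D.iy
  | some z => D.QG.lst (D.iQ z)

/-- **The glued walks**: `P_x ++ xy ++ Q_y` (index `none`) and `P_z ++ Q_z` (index `some z`,
`z ∈ X`). [cite: Diestel2017, Thm. 3.3.1 (third proof)] -/
def glueWalk : ∀ o : Option (↑D.X : Set V), G.Walk (D.glueFst o) (D.glueLst o)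
  | none => D.pthx.append (Walk.cons D.adj D.qthy)
  | some z => (D.pthz z).append (D.qthz z)

/-- The vertices of the glued walk `P_x ++ xy ++ Q_y`. [cite: Diestel2017, Thm. 3.3.1 (third proof)] -/
theorem mem_support_glueWalk_none {w : V} :
    w ∈ (D.glueWalk none).support ↔
      w ∈ (D.P.walk D.ix).support ∨ w ∈ (D.Q.walk D.iy).support := by
  show w ∈ (D.pthx.append (Walk.cons D.adj D.qthy)).support ↔ _
  rw [Walk.mem_support_append_iff, Walk.support_cons, List.mem_cons, support_pthx, support_qthy]
  constructor
  · rintro (h | rfl | h)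
    · exact Or.inl h
    · exact Or.inl (D.coe_mem_support_P D.ix)
    · exact Or.inr h
  · rintro (h | h)
    · exact Or.inl h
    · exact Or.inr (Or.inr h)

/-- The vertices of the glued walk `P_z ++ Q_z`. [cite: Diestel2017, Thm. 3.3.1 (third proof)] -/
theorem mem_support_glueWalk_some {z : (↑D.X : Set V)} {w : V} :
    w ∈ (D.glueWalk (some z)).support ↔
      w ∈ (D.P.walk (D.iP z)).support ∨ w ∈ (D.Q.walk (D.iQ z)).support := by
  show w ∈ ((D.pthz z).append (D.qthz z)).support ↔ _
  rw [Walk.mem_support_append_iff, support_pthz, support_qthz]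

/-! ### The glued system -/

/-- The glued walks are paths. [cite: Diestel2017, Thm. 3.3.1 (third proof)] -/
theorem isPath_glueWalk : ∀ o, (D.glueWalk o).IsPath
  | none => by
    show (D.pthx.append (Walk.cons D.adj D.qthy)).IsPath
    rw [isPath_append_iff']
    refine ⟨D.isPath_pthx, ?_, fun w hw hw' => ?_⟩
    · refine D.isPath_qthy.cons ?_
      rw [support_qthy]
      exact D.x_notMem_support_Q _
    · rw [Walk.support_cons, List.mem_cons, support_qthy] at hw'
      rcases hw' with h | h
      · exact h
      · rw [support_pthx] at hw
        have hc := D.cross hw h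
        exact absurd hc.1 (by rw [hc.2.1]; exact D.x_notMem)
  | some z => by
    show ((D.pthz z).append (D.qthz z)).IsPath
    rw [isPath_append_iff']
    refine ⟨D.isPath_pthz z, D.isPath_qthz z, fun w hw hw' => ?_⟩
    rw [support_pthz] at hw
    rw [support_qthz] at hw'
    exact (D.cross hw hw').2.1

/-- The glued walks meet `A` only in their first vertices. [cite: Diestel2017, Thm. 3.3.1 (third proof)] -/
theorem eq_glueFst_of_mem : ∀ o, ∀ a ∈ (D.glueWalk o).support, a ∈ A → a = D.glueFst o
  | none, a, ha, haA => by
    rw [mem_support_glueWalk_none] at ha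
    rcases ha with ha | ha
    · exact D.P.eq_fst_of_mem _ a ha haA
    · exact absurd (D.eq_of_mem_Q_of_mem_A ha haA).2 D.y_notMem
  | some z, a, ha, haA => by
    rw [mem_support_glueWalk_some] at ha
    rcases ha with ha | ha
    · exact D.P.eq_fst_of_mem _ a ha haA
    · have haz : a = z := (D.eq_of_mem_Q_of_mem_A ha haA).1
      subst haz
      exact D.P.eq_fst_of_mem _ _ (D.coe_mem_support_P (D.iP z)) haA

/-- The glued walks meet `B` only in their last vertices. [cite: Diestel2017, Thm. 3.3.1 (third proof)] -/
theorem eq_glueLst_of_mem : ∀ o, ∀ b ∈ (D.glueWalk o).support, b ∈ B → b = D.glueLst o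
  | none, b, hb, hbB => by
    rw [mem_support_glueWalk_none] at hb
    rcases hb with hb | hb
    · exact absurd (D.eq_of_mem_P_of_mem_B hb hbB).2 D.x_notMem
    · exact D.Q.eq_lst_of_mem _ b hb hbB
  | some z, b, hb, hbB => by
    rw [mem_support_glueWalk_some] at hb
    rcases hb with hb | hb
    · have hbz : b = z := (D.eq_of_mem_P_of_mem_B hb hbB).1
      subst hbz
      exact D.Q.eq_lst_of_mem _ _ (D.coe_mem_support_Q (D.iQ z)) hbB
    · exact D.Q.eq_lst_of_mem _ b hb hbB

/-- A `P`-path through `z ∈ X` and the `Q`-path from `y` are disjoint, and so are `P_x` and a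
`Q`-path from `z ∈ X`; two glued paths with distinct indices are disjoint.
[cite: Diestel2017, Thm. 3.3.1 (third proof)] -/
theorem disjoint_glueWalk_some_none (z : (↑D.X : Set V)) :
    List.Disjoint (D.glueWalk (some z)).support (D.glueWalk none).support := by
  intro w hw hw'
  rw [mem_support_glueWalk_some] at hw
  rw [mem_support_glueWalk_none] at hw'
  have hzx : D.iP z ≠ D.ix := fun h => D.x_notMem (by
    have := congrArg Subtype.val h; simp at this; rw [← this]; exact z.2)
  have hzy : D.iQ z ≠ D.iy := fun h => D.y_notMem (by
    have := congrArg Subtype.val h; simp at this; rw [← this]; exact z.2)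
  rcases hw with hw | hw <;> rcases hw' with hw' | hw'
  · exact D.P.disjoint _ _ hzx hw hw'
  · have h := D.cross hw hw'
    exact D.y_notMem (by have h3 := h.2.2; simp at h3; rw [← h3]; exact h.1)
  · have h := D.cross hw' hw
    exact D.x_notMem (by have h3 := h.2.1; simp at h3; rw [← h3]; exact h.1)
  · exact D.Q.disjoint _ _ hzy hw hw'

/-- Glued walks through distinct `z, z' ∈ X` are disjoint. [cite: Diestel2017, Thm. 3.3.1 (third proof)] -/
theorem disjoint_glueWalk_some_some {z z' : (↑D.X : Set V)} (hzz' : z ≠ z') :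
    List.Disjoint (D.glueWalk (some z)).support (D.glueWalk (some z')).support := by
  intro w hw hw'
  rw [mem_support_glueWalk_some] at hw hw'
  have hne : (z : V) ≠ z' := fun h => hzz' (Subtype.ext h)
  rcases hw with hw | hw <;> rcases hw' with hw' | hw'
  · exact D.P.disjoint _ _ (fun h => hne (by simpa using congrArg Subtype.val h)) hw hw'
  · have h := D.cross hw hw'
    exact hne (by have h2 := h.2.1; have h3 := h.2.2; simp at h2 h3; rw [← h2, ← h3])
  · have h := D.cross hw' hw
    exact hne (by have h2 := h.2.1; have h3 := h.2.2; simp at h2 h3; rw [← h2, ← h3])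
  · exact D.Q.disjoint _ _ (fun h => hne (by simpa using congrArg Subtype.val h)) hw hw'

/-- **The glued system**: `|X| + 1` pairwise disjoint `A`–`B` paths of `G`, indexed by `Option X`.
[cite: Diestel2017, Thm. 3.3.1 (third proof)] -/
def glue : ABPathSystem G A B (Option (↑D.X : Set V)) where
  fst := D.glueFst
  lst := D.glueLst
  walk := D.glueWalk
  fst_mem o := match o with
    | none => D.P.fst_mem _
    | some _ => D.P.fst_mem _
  lst_mem o := match o with
    | none => D.Q.lst_mem _
    | some _ => D.Q.lst_mem _
  isPath := D.isPath_glueWalk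
  eq_fst_of_mem := D.eq_glueFst_of_mem
  eq_lst_of_mem := D.eq_glueLst_of_mem
  disjoint o o' hoo' := match o, o' with
    | none, none => absurd rfl hoo'
    | none, some z => (D.disjoint_glueWalk_some_none z).symm
    | some z, none => D.disjoint_glueWalk_some_none z
    | some _, some _ => D.disjoint_glueWalk_some_some fun h => hoo' (congrArg some h)

end GluingData

end Literature.Combinatorics.SimpleGraph
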